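import Literature.AlgebraicGeometry.Frobenioids.PadicFrobenioidSlim
import Literature.AlgebraicGeometry.Frobenioids.PadicFrobenioidStandardType
import Mathlib.CategoryTheory.SingleObj
import HarnessLib

/-!
# Frobenioids I, Proposition 1.13 (iii): condition (b) `SlimHypothesisB F X` is a SCHEMA —
# universal closure refuted; instance forms at `p`-adic Frobenioids proved ([FrdII] Thm. 1.2 (iv))

Mochizuki, *The geometry of Frobenioids I: the general theory*, Kyushu J. Math. **62** (2008), §1,
Proposition 1.13 (iii), kurims pp. 39–40 [cite: MochizukiFrdI2008, Prop. 1.13(iii) p.40]: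
"(iii) Suppose, moreover, that every object `A ∈ Ob(C)` satisfies [at least] one of the following two
conditions: (a) `O^×(A)^{imtr-pre} = {1}`; (b) `⋂_{n ∈ ℕ_{≥1}} {O^×(A)}^n = {1}`, and, moreover, there
exists a co-angular pre-step `B → A` such that `B` is quasi-Frobenius-trivial and Frobenius-normalized.
Then the category `C` is slim."  And *The geometry of Frobenioids II*, Kyushu J. Math. **62** (2008), §1,
Theorem 1.2 (iv), kurims p. 9 [cite: MochizukiFrdII2008, Thm 1.2 (iv) p.9]: "`C` is also slim … follows
formally from [FrdI], Proposition 1.13, (iii) [since, by assertion (i), condition (b) of loc. cit. is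
always satisfied by objects of `C`]".

PROOF-ONLY companion (no definitions, no instances) of abc-iut-L1-t1's `RigiditySlimness.lean` (FACT-LIST
row **F-2393** `PreFrobenioid.SlimHypothesisB`, `structure … : Prop`, class `preparatory`, status
`conditional`), abc-iut cell seat abc-iut-f-049.

`SlimHypothesisB F X` is the HYPOTHESIS (b) of Prop. 1.13 (iii) at an object `X` of an ARBITRARY
pre-Frobenioid structure functor `F : C → F_Φ`; it is a genuine restriction (Prop. 1.13 (iii) needs (a) or
(b); [FrdI] Remark 1.13.1 exhibits non-slim Frobenioids), so its universal closure is false.  In the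
kernel: a nontrivial infinitely divisible element of `O^×(X)` violates the first clause of (b)
(`not_slimHypothesisB_of_divisible`); for the constant structure functor on the one-object category of the
group `(ℚ, +)` every automorphism is a base-identity linear automorphism (`unitsSubgroup_const_eq_top`),
and `1 ∈ ℚ` is a nontrivial infinitely divisible unit (`not_slimHypothesisB_const_singleObj_rat`); hence
`not_forall_slimHypothesisB`.

INSTANCE FORMS.  The cone consumes (b) at genuine Frobenioids, where it is PROVED:
* at the tempered Frobenioid of [EtTh] Thm. 3.7 (iv): `TemperedFrobenioid.slimHypothesisB`
  (`EtaleTheta/Discharge/Sec3Thm37SubQFT.lean`, abc-iut-L6-t13) — cited, not restated;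
* at `p`-adic Frobenioids ([FrdII] Ex. 1.1 (ii), Thm. 1.2 (iv) "condition (b) … is always satisfied by
  objects of `C`"): `PadicFrd.Datum.slimHypothesisB` below — the two clauses of abc-iut-L1-d8's inline
  argument in `PadicFrobenioidSlim.lean` (`thm12_iv_of_isFrobenioid`) as a NAMED theorem: an infinitely
  divisible element of `O^×(X) ↪ O_{K_X}^×` is `1` (`PadicUnitsDivisible`), and `id_X` is a co-angular
  pre-step from the quasi-Frobenius-trivial, Frobenius-normalized object `X`; premise-free over bases of
  FSM-type (`slimHypothesisB_of_isOfFSMType`, the Frobenioid axiom being [FrdII] Ex. 1.1 (ii)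
  `isFrobenioid_of_isOfFSMType`).

So F-2393 is admissible AT NAMED INSTANCES ONLY (FACT-LIST class «universal-closure REFUTED / schema;
instance forms PROVED»).  Bookkeeping about the typing; nothing here bears on [IUTchIII] Cor. 3.12 or
takes a side; a refuted closure is a statement about the schema, not about the paper.
-/

namespace Literature.AlgebraicGeometry.Frobenioids

open CategoryTheory Opposite

universe w v v' u u'

namespace PreFrobenioid

variable {D : Type u} [Category.{v} D] {Φ : Dᵒᵖ ⥤ CommMonCat.{w}} {C : Type u'} [Category.{v'} C]
  (F : C ⥤ ElemFrobenioid Φ)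

/-! ### The closure is false -/

/-- A nontrivial element of `O^×(X)` admitting an `n`-th root in `O^×(X)` for every `n ≥ 1` violates the
first clause "`⋂_n {O^×(X)}^n = {1}`" of condition (b). [cite: MochizukiFrdI2008, Prop. 1.13(iii) p.40] -/
theorem not_slimHypothesisB_of_divisible {X : C} (v : Aut X) (hv : v ∈ unitsSubgroup F X) (hv1 : v ≠ 1)
    (hdiv : ∀ n : ℕ+, ∃ u : Aut X, u ∈ unitsSubgroup F X ∧ u ^ (n : ℕ) = v) :
    ¬ SlimHypothesisB F X := fun h =>
  hv1 (h.eq_one_of_forall_pow v hv hdiv)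

/-- For a CONSTANT structure functor `C → F_Φ` (every arrow goes to an identity of `F_Φ`) every
automorphism is a base-identity linear automorphism: `O^×(X) = Aut_C(X)`.
[cite: MochizukiFrdI2008, Def. 1.2(ii) p.22] -/
theorem unitsSubgroup_const_eq_top (E : ElemFrobenioid Φ) (X : C) :
    unitsSubgroup ((Functor.const C).obj E) X = ⊤ := by
  ext v
  simp only [Subgroup.mem_top, iff_true]
  exact ⟨rfl, rfl⟩

/-- **F-2393 is a schema**: for the constant structure functor on the one-object category of the group
`(ℚ, +)`, condition (b) FAILS at the object — `O^×(X) = ℚ` and `1 ∈ ℚ` is nontrivial and infinitely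
divisible (`1 = n · (1/n)`). [cite: MochizukiFrdI2008, Prop. 1.13(iii) p.40] -/
theorem not_slimHypothesisB_const_singleObj_rat (E : ElemFrobenioid Φ) :
    ¬ SlimHypothesisB ((Functor.const (SingleObj (Multiplicative ℚ))).obj E)
      (SingleObj.star (Multiplicative ℚ)) := by
  let e : Multiplicative ℚ ≃* Aut (SingleObj.star (Multiplicative ℚ)) :=
    toUnits.trans (Units.toAut (Multiplicative ℚ))
  refine not_slimHypothesisB_of_divisible _ (e (Multiplicative.ofAdd 1)) ?_ ?_ ?_
  · rw [unitsSubgroup_const_eq_top]; trivial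
  · intro h
    have h1 : Multiplicative.ofAdd (1 : ℚ) = Multiplicative.ofAdd 0 :=
      e.injective (h.trans (map_one e).symm)
    exact one_ne_zero (Multiplicative.ofAdd.injective h1)
  · intro n
    refine ⟨e (Multiplicative.ofAdd ((n : ℚ)⁻¹)), ?_, ?_⟩
    · rw [unitsSubgroup_const_eq_top]; trivial
    · rw [← map_pow, ← ofAdd_nsmul, nsmul_eq_mul,
        mul_inv_cancel₀ (Nat.cast_ne_zero.mpr (PNat.ne_zero n))]

/-- **The universal closure of F-2393 is false** (witness: the trivial monoid `Φ = 1` on the one-point base,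
`C` the one-object category of `(ℚ, +)`, `F` constant); the printed use of (b) is at genuine Frobenioids,
where it is a theorem (`PadicFrd.Datum.slimHypothesisB`, `TemperedFrobenioid.slimHypothesisB`).
[cite: MochizukiFrdI2008, Prop. 1.13(iii) p.40] -/
theorem not_forall_slimHypothesisB :
    ¬ ∀ (D : Type) (_ : Category.{0} D) (Φ : Dᵒᵖ ⥤ CommMonCat.{0}) (C : Type) (_ : Category.{0} C)
        (F : C ⥤ ElemFrobenioid Φ) (X : C), SlimHypothesisB F X := fun h =>
  not_slimHypothesisB_const_singleObj_rat
    (Φ := (Functor.const (Discrete PUnit.{1})ᵒᵖ).obj (CommMonCat.of PUnit.{1}))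
    (ElemFrobenioid.of _ ⟨PUnit.unit⟩) (h _ _ _ _ _ _ _)

end PreFrobenioid

/-! ### Instance forms at `p`-adic Frobenioids ([FrdII] Thm. 1.2 (iv)) -/

namespace PadicFrd.Datum

open ValuativeRel

variable {D : Type u} [Category.{v} D] {p : ℕ} [Fact p.Prime] (d : Datum D p)

/-- **[FrdII] Thm. 1.2 (iv), "condition (b) of loc. cit. is always satisfied by objects of `C`"**, first
clause, for the `p`-adic Frobenioid: an element of `O^×(X)` that is an `n`-th power in `O^×(X)` for every
`n ≥ 1` is trivial — `O^×(X) ↪ O_{K_X}^×` (abc-iut-L1-d10's `exists_unitsHom`) and an infinitely divisible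
unit of a finite extension of `ℚ_p` is `1` (`PadicUnitsDivisible`). [cite: MochizukiFrdII2008, Thm 1.2 (iv) p.9] -/
theorem unitsSubgroup_eq_one_of_forall_pow (X : d.frobenioid) (v : Aut X)
    (hv : v ∈ PreFrobenioid.unitsSubgroup d.structureFunctor X)
    (hdiv : ∀ n : ℕ+, ∃ u : Aut X, u ∈ PreFrobenioid.unitsSubgroup d.structureFunctor X ∧ u ^ (n : ℕ) = v) :
    v = 1 := by
  obtain ⟨θ, hθinj, hθval, -⟩ := d.exists_unitsHom X
  obtain ⟨inst, hfin, hc⟩ := (d.isPadicLocal X.base).exists_finite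
  letI := inst
  haveI := hfin
  have key : ((θ ⟨v, hv⟩ : (d.fld X.base)ˣ) : d.fld X.base) = 1 := by
    refine eq_one_of_valuation_eq_one_of_forall_exists_pow_eq hc (hθval ⟨v, hv⟩) fun n hn => ?_
    obtain ⟨u, hu, hun⟩ := hdiv ⟨n, hn⟩
    refine ⟨((θ ⟨u, hu⟩ : (d.fld X.base)ˣ) : d.fld X.base), ?_⟩
    have h : (⟨u, hu⟩ : PreFrobenioid.unitsSubgroup d.structureFunctor X) ^ n = ⟨v, hv⟩ :=
      Subtype.ext hun
    rw [← Units.val_pow_eq_pow_val, ← map_pow, h]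
  have h1 : θ ⟨v, hv⟩ = 1 := Units.val_eq_one.mp key
  have h2 : (⟨v, hv⟩ : PreFrobenioid.unitsSubgroup d.structureFunctor X) = 1 :=
    hθinj (h1.trans (map_one θ).symm)
  exact congrArg Subtype.val h2

/-- **[FrdII] Thm. 1.2 (iv), condition (b) at every object of a `p`-adic Frobenioid** (the instance form of
F-2393 at [FrdII] Ex. 1.1 (ii)), GIVEN that `C → F_Φ` is a Frobenioid ([FrdI] Thm. 5.2 (ii)):
`⋂_n (O^×(X))^n = {1}` (`unitsSubgroup_eq_one_of_forall_pow`) and `id_X : X → X` is a co-angular pre-step from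
the quasi-Frobenius-trivial (`Div_B`-cofinality) and Frobenius-normalized (model Frobenioid) object `X`.
[cite: MochizukiFrdII2008, Thm 1.2 (iv) p.9] -/
theorem slimHypothesisB (hF : PreFrobenioid.IsFrobenioid d.structureFunctor) (X : d.frobenioid) :
    PreFrobenioid.SlimHypothesisB d.structureFunctor X where
  eq_one_of_forall_pow := d.unitsSubgroup_eq_one_of_forall_pow X
  exists_preStep := ⟨X, 𝟙 X,
    ⟨PreFrobenioid.isCoAngular_of_isIso d.structureFunctor hF.isPreFrobenioid.isTotallyEpimorphic (𝟙 X),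
      PreFrobenioid.isPreStep_of_isIso d.structureFunctor (𝟙 X)⟩,
    ModelFrobenioid.isQuasiFrobeniusTrivial_of_cofinal d.divB_cofinal X,
    ModelFrobenioid.isFrobeniusNormalized X⟩

/-- **[FrdII] Thm. 1.2 (iv), condition (b)** at every object of a `p`-adic Frobenioid over a base of
FSM-type, PREMISE-FREE (the Frobenioid axiom is [FrdII] Ex. 1.1 (ii), `isFrobenioid_of_isOfFSMType`).
[cite: MochizukiFrdII2008, Thm 1.2 (iv) p.9] -/
theorem slimHypothesisB_of_isOfFSMType (hD : IsOfFSMType D) (X : d.frobenioid) :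
    PreFrobenioid.SlimHypothesisB d.structureFunctor X :=
  d.slimHypothesisB (d.isFrobenioid_of_isOfFSMType hD) X

/-- Hence the disjunction "(a) or (b) at every object" of [FrdI] Prop. 1.13 (iii) holds for a `p`-adic
Frobenioid over a base of FSM-type, through (b). [cite: MochizukiFrdII2008, Thm 1.2 (iv) p.9] -/
theorem slimHypothesis_of_isOfFSMType (hD : IsOfFSMType D) (X : d.frobenioid) :
    PreFrobenioid.unitsSubgroupImtrPre (F := d.structureFunctor)
        (d.isFrobenioid_of_isOfFSMType hD).isPreFrobenioid X = ⊥ ∨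
      PreFrobenioid.SlimHypothesisB d.structureFunctor X :=
  Or.inr (d.slimHypothesisB_of_isOfFSMType hD X)

/-- **[FrdII] Thm. 1.2 (iv)** (abc-iut-L1-t4's named `Thm12_iv d`: "If `D` is slim, then `C` is also slim")
for a `p`-adic Frobenioid over a base of FSM-type, PREMISE-FREE ([FrdI] Prop. 1.13 (iii) via (b) at every
object; the `IsMonoidData` premise of abc-iut-L1-d8's `thm12_iv_of_isMonoidData` is automatic over FSM-type
bases). [cite: MochizukiFrdII2008, Thm 1.2 (iv) p.9] -/
theorem thm12_iv_of_isOfFSMType (hD : IsOfFSMType D) : Thm12_iv d := fun hslim =>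
  PreFrobenioid.isSlim (d.isFrobenioid_of_isOfFSMType hD) hslim (d.slimHypothesis_of_isOfFSMType hD)

end PadicFrd.Datum

end Literature.AlgebraicGeometry.Frobenioids
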